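import Literature.LinearAlgebra.Matrix.QInversiveCharpoly
import Literature.Algebra.Polynomial.RealCounterpartWeilPolynomial
import HarnessLib

/-!
# Goresky–Tai 2017, Lemma 12 (4.3): for a `q`-inversive `γ = (A B; C ᵗA)` whose characteristic polynomial is a
# Weil `q`-polynomial, every eigenvalue `β` of `A` is real with `|β| < √q` — and the converse sentence

Topic `Literature/LinearAlgebra/Matrix`; THEOREMS ONLY (no definition, no instance, no named fact; D-0026 net
debt 0).  Lane `lit-hodgefound` (summit `HodgeConjecture`, Track 2 foundations library), seat
`lit-hodgefound-p15`, generation 56, row g56-#7; it joins `QInversiveCharpoly` (g56-#3: `p_γ = xⁿ p_{2A}(x+q/x)`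
over a domain) with `Literature.Algebra.Polynomial.RealCounterpartWeilPolynomial` (g56-#2: roots of `xⁿh(x+q/x)`
versus roots of `h` over `ℂ`).

THE PRINT.  M. Goresky, Y.-S. Tai, *Real structures on ordinary Abelian varieties*, arXiv:1701.07742
[GoreskyTai2017RealStructuresOrdinary], §4.1 Lemma 12 (p0011), verbatim: «If these properties hold then the
matrix `A` is semisimple, and the characteristic polynomial of `A` is `h(2x)`, where `h(x)` is the real
counterpart (see §16.2) to `p(x)`, the characteristic polynomial of `γ`. If `p(x)` is also a Weil `q`-polynomial
then every eigenvalue `β` of `A` satisfies `|β| < √q` (4.3). Conversely, let `A ∈ GL_n(ℚ)` be semisimple and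
suppose that its eigenvalues `β_1, ⋯, β_n` (not necessarily distinct) are totally real and that `|β_r| < √q` for
`1 ≤ r ≤ n`. Then for any symmetric nonsingular matrix `C ∈ GL_n(ℚ)` such that `ᵗAC = CA`, the following element
`γ = (A, (A² − qI)C⁻¹; C, ᵗA) ∈ GSp_{2n}(ℚ)` is `q`-inversive and its eigenvalues, `α_r = β_r ± √(β_r² − q)`
(`1 ≤ r ≤ n`), are Weil `q`-numbers. … The inequality (4.3) follows from Proposition 36 part (2).»

WHAT IS HERE (over `ℂ`, `q > 0` real; `γ = (A B; C ᵗA)` with the `q`-inversive relations of #3 — a rational or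
real `q`-inversive `γ` is read in `ℂ` through the coefficient embedding; «eigenvalue of `A`» = root of `p_A` in
`ℂ`; «Weil `q`-polynomial» = every complex root has `|α|² = q`; as in the print, (4.3) is the STRICT bound and
uses that `p` has no real roots, which is part of the printed notion of `q`-inversive data «with no real roots» —
see #2's scope note: the closed bound `|β| ≤ √q` holds for every Weil `p_γ`, the strict one iff `p_γ` has no real
roots):
* `eval_charpoly_add_self` (`p_{A+A}(2β) = 2ⁿ p_A(β)`, any commutative ring), `mem_roots_charpoly_add_self_iff`
  (`2β` is a root of `p_{2A}` iff `β` is a root of `p_A`, field with `2 ≠ 0`);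
* **`eigenvalue_real_and_sq_le`** — if `p_γ` is Weil then every root `β` of `p_A` is real with `β² ≤ q`;
  **`eigenvalue_sq_lt`** — (4.3): if moreover `p_γ` has no real root then `β² < q` (`|β| < √q`);
* the converse sentence **`weil_no_real_roots_of_eigenvalues`** — if every root of `p_A` is real with `β² < q`
  then every root `α` of `p_γ` has `|α|² = q` and is non-real («its eigenvalues `β_r ± √(β_r² − q)` are Weil
  `q`-numbers»; the algebraic half — that `(A, (A²−qI)C⁻¹; C, ᵗA)` is `q`-inversive — is
  `QInversiveCompanion.completion_relations_left`).
NOT here: «`A` is semisimple».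

## References
* [GoreskyTai2017RealStructuresOrdinary] M. Goresky, Y.-S. Tai, Real structures on ordinary Abelian varieties,
  arXiv:1701.07742 (2017), §4.1 Lemma 12, display (4.3) and the converse paragraph (p0011).
-/

open Matrix Polynomial Finset Complex

namespace Literature.LinearAlgebra.Matrix.QInversiveEigenvalueBound

open Literature.Algebra.Polynomial

/-! ## §1 `p_{2A}(2β) = 2ⁿ p_A(β)` -/

section CommRing

variable {R : Type*} [CommRing R] {m : Type*} [Fintype m] [DecidableEq m]

/-- `p_{A+A}(2β) = 2ⁿ · p_A(β)` («the characteristic polynomial of `A` is `h(2x)`», up to the factor `2ⁿ`).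
[cite: GoreskyTai2017RealStructuresOrdinary, §4.1 Lemma 12 «the characteristic polynomial of A is h(2x)» (p0011)] -/
theorem eval_charpoly_add_self (A : Matrix m m R) (β : R) :
    (A + A).charpoly.eval (2 * β) = 2 ^ Fintype.card m * A.charpoly.eval β := by
  have key : scalar m (2 * β) - (A + A) = (2 : R) • (scalar m β - A) := by
    refine Matrix.ext fun i j => ?_
    by_cases h : i = j
    · subst h
      simp only [Matrix.sub_apply, Matrix.add_apply, Matrix.smul_apply, scalar_apply, diagonal_apply_eq,
        smul_eq_mul]
      ring
    · simp only [Matrix.sub_apply, Matrix.add_apply, Matrix.smul_apply, scalar_apply, diagonal_apply_ne _ h,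
        smul_eq_mul]
      ring
  rw [eval_charpoly, eval_charpoly, key, det_smul]

end CommRing

section Field

variable {K : Type*} [Field K] {m : Type*} [Fintype m] [DecidableEq m]

/-- `2β` is a root of `p_{2A}` iff `β` is a root of `p_A` (`2 ≠ 0`). [cite: GoreskyTai2017RealStructuresOrdinary, §4.1 proof of Lemma 12 (b) «u is an eigenvector of A with eigenvalue ½(λ + q/λ)» (p0011)] -/
theorem mem_roots_charpoly_add_self_iff (h2 : (2 : K) ≠ 0) (A : Matrix m m K) (β : K) :
    2 * β ∈ (A + A).charpoly.roots ↔ β ∈ A.charpoly.roots := by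
  rw [mem_roots (charpoly_monic _).ne_zero, mem_roots (charpoly_monic _).ne_zero, IsRoot.def, IsRoot.def,
    eval_charpoly_add_self, mul_eq_zero, or_iff_right (pow_ne_zero _ h2)]

/-- Every root of `p_{2A}` is `2β` for a root `β` of `p_A` (`2 ≠ 0`). [cite: GoreskyTai2017RealStructuresOrdinary, §4.1 proof of Lemma 12 (b) (p0011)] -/
theorem forall_mem_roots_charpoly_add_self_iff (h2 : (2 : K) ≠ 0) (A : Matrix m m K) (P : K → Prop) :
    (∀ β' ∈ (A + A).charpoly.roots, P β') ↔ ∀ β ∈ A.charpoly.roots, P (2 * β) := by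
  constructor
  · intro H β hβ
    exact H _ ((mem_roots_charpoly_add_self_iff h2 A β).mpr hβ)
  · intro H β' hβ'
    have h : β' = 2 * (β' / 2) := by field_simp
    rw [h] at hβ' ⊢
    exact H _ ((mem_roots_charpoly_add_self_iff h2 A _).mp hβ')

end Field

/-! ## §2 Over `ℂ`: the eigenvalue bound (4.3) and the converse sentence -/

section Complex

variable {m : Type*} [Fintype m] [DecidableEq m]

/-- `(2β).im = 2·β.im`, `(2β).re = 2·β.re`. [folklore] -/
private theorem two_mul_im_re (β : ℂ) : (2 * β).im = 2 * β.im ∧ (2 * β).re = 2 * β.re := by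
  constructor <;> simp [Complex.mul_im, Complex.mul_re]

/-- **If `p_γ` is a Weil `q`-polynomial then every eigenvalue `β` of `A` is real with `β² ≤ q`** (closed bound;
`γ = (A B; C ᵗA)` `q`-inversive over `ℂ`, `q > 0`). [cite: GoreskyTai2017RealStructuresOrdinary, §4.1 Lemma 12 «If p(x) is also a Weil q-polynomial then every eigenvalue β of A satisfies |β| < √q» with «The inequality (4.3) follows from Proposition 36 part (2)» (p0011)] -/
theorem eigenvalue_real_and_sq_le {A B C : Matrix m m ℂ} {q : ℝ} (hq0 : 0 < q) (hB : Bᵀ = B) (hC : Cᵀ = C)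
    (hAB : A * B = B * Aᵀ) (hCA : C * A = Aᵀ * C) (hq : A * A - B * C = (q : ℂ) • (1 : Matrix m m ℂ))
    (hweil : ∀ α ∈ (fromBlocks A B C Aᵀ).charpoly.roots, normSq α = q) :
    ∀ β ∈ A.charpoly.roots, β.im = 0 ∧ β.re ^ 2 ≤ q := by
  rw [QInversiveCharpoly.charpoly_eq_transform_charpoly_two_smul hB hC hAB hCA hq] at hweil
  have H := (RealCounterpartWeilPolynomial.weil_iff_totallyReal_bounded hq0 (Fintype.card m)
    (charpoly_monic (A + A)) (charpoly_natDegree_eq_dim (A + A))).mp hweil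
  rw [forall_mem_roots_charpoly_add_self_iff two_ne_zero] at H
  intro β hβ
  obtain ⟨h1, h2⟩ := H β hβ
  rw [(two_mul_im_re β).1] at h1
  rw [(two_mul_im_re β).2] at h2
  exact ⟨by linarith [h1] , by nlinarith [h2]⟩

/-- **(4.3): if `p_γ` is a Weil `q`-polynomial with no real roots then every eigenvalue `β` of `A` is real with
`β² < q`, i.e. `|β| < √q`.** [cite: GoreskyTai2017RealStructuresOrdinary, §4.1 Lemma 12 display (4.3) «|β| < √q» (p0011)] -/
theorem eigenvalue_sq_lt {A B C : Matrix m m ℂ} {q : ℝ} (hq0 : 0 < q) (hB : Bᵀ = B) (hC : Cᵀ = C)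
    (hAB : A * B = B * Aᵀ) (hCA : C * A = Aᵀ * C) (hq : A * A - B * C = (q : ℂ) • (1 : Matrix m m ℂ))
    (hweil : ∀ α ∈ (fromBlocks A B C Aᵀ).charpoly.roots, normSq α = q ∧ α.im ≠ 0) :
    ∀ β ∈ A.charpoly.roots, β.im = 0 ∧ β.re ^ 2 < q := by
  rw [QInversiveCharpoly.charpoly_eq_transform_charpoly_two_smul hB hC hAB hCA hq] at hweil
  have H := (RealCounterpartWeilPolynomial.weil_no_real_roots_iff hq0 (Fintype.card m)
    (charpoly_monic (A + A)) (charpoly_natDegree_eq_dim (A + A))).mp hweil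
  rw [forall_mem_roots_charpoly_add_self_iff two_ne_zero] at H
  intro β hβ
  obtain ⟨h1, h2⟩ := H β hβ
  rw [(two_mul_im_re β).1] at h1
  rw [(two_mul_im_re β).2] at h2
  exact ⟨by linarith [h1], by nlinarith [h2]⟩

/-- **The converse sentence of Lemma 12**: if every eigenvalue `β` of `A` is real with `β² < q` then every root
`α` of `p_γ` has `|α|² = q` and is non-real («its eigenvalues `α_r = β_r ± √(β_r² − q)` are Weil `q`-numbers»).
[cite: GoreskyTai2017RealStructuresOrdinary, §4.1 Lemma 12 «Conversely … its eigenvalues, α_r = β_r ± √(β_r² − q) (1 ≤ r ≤ n), are Weil q-numbers» (p0011)] -/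
theorem weil_no_real_roots_of_eigenvalues {A B C : Matrix m m ℂ} {q : ℝ} (hq0 : 0 < q) (hB : Bᵀ = B)
    (hC : Cᵀ = C) (hAB : A * B = B * Aᵀ) (hCA : C * A = Aᵀ * C)
    (hq : A * A - B * C = (q : ℂ) • (1 : Matrix m m ℂ))
    (heig : ∀ β ∈ A.charpoly.roots, β.im = 0 ∧ β.re ^ 2 < q) :
    ∀ α ∈ (fromBlocks A B C Aᵀ).charpoly.roots, normSq α = q ∧ α.im ≠ 0 := by
  rw [QInversiveCharpoly.charpoly_eq_transform_charpoly_two_smul hB hC hAB hCA hq]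
  refine (RealCounterpartWeilPolynomial.weil_no_real_roots_iff hq0 (Fintype.card m)
    (charpoly_monic (A + A)) (charpoly_natDegree_eq_dim (A + A))).mpr ?_
  rw [forall_mem_roots_charpoly_add_self_iff two_ne_zero]
  intro β hβ
  obtain ⟨h1, h2⟩ := heig β hβ
  rw [(two_mul_im_re β).1, (two_mul_im_re β).2, h1, mul_zero]
  exact ⟨rfl, by nlinarith [h2]⟩

end Complex

end Literature.LinearAlgebra.Matrix.QInversiveEigenvalueBound
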